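import Summits.BirchSwinnertonDyer.BirchSwinnertonDyer.Theorems.ResidualThetaTransportAtTwoThetaLayerLambdaCongruenceAtTwoHeckeAdjointKappaFinite
import Summits.BirchSwinnertonDyer.BirchSwinnertonDyer.Theorems.ResidualThetaTransportAtTwoThetaLayerLambdaCongruenceAtTwoHeckeAdjointDualSide
import Summits.BirchSwinnertonDyer.BirchSwinnertonDyer.Theorems.ResidualThetaTransportAtTwoThetaLayerLambdaCongruenceAtTwoHeckeAdjointManinChain
import HarnessLib

/-!
# Crux `ThetaLayerLambdaCongruenceAtTwo` (stmt-BirchSwinnertonDyer-20688, route ResidualThetaTransportAtTwo), line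
# `birth` v14 — SD floor, kernel road, Hecke clause of IP, brick HA8-M «MANIN SIDE, one block»: for the re-expansion `g₀·P` of the
# generalised edge `C = M·g·S` and a dual chain `D` of `γ`, twice the crossing count of `D` with the re-expanded block equals the flag sum
# `Σ'_{u∈Γ₀(N)} [F(g⁻¹·adj(M)·u⁻¹·γ) − F(g⁻¹·adj(M)·u⁻¹)]` (width seat bsd-wall-rtt-p3-w3 g11; `--supports stmt-BirchSwinnertonDyer-20688 --as helper`)

HONEST FRAMING. THEOREMS only about lists of matrices and finitely supported sums over `Γ₀(N)`; no definition; nothing about any curve or form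
is asserted; BSD is not proved by any of this.

WHAT (memo `Cruxes/ThetaLayerLambdaCongruenceAtTwo/Lines/birth-sd2-hecke-adjoint.md`, steps (C)–(E), Manin side). `manin_block`: with the data
of `exists_reexpansion` for `C = g₀·(u v; 0 w)` and any `D` telescoping from `1` to `γ`:
`2·Σ_{f∈P} vec(D)((g₀fS)⁻¹Γ₀) = Σ'_{u} [F(S⁻¹·adj(C)·... )]`, precisely `= Σ'_u [F(adj(S)⁻¹…)]` in the form
`Σ'_{u∈Γ₀(N)} −[F(adj(C)·u⁻¹·γ) − F(adj(C)·u⁻¹)]` — side formula (HA3) + edge reversal for the steps `g₀fS` + the tautology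
`Σ_f G₁((g₀f)⁻¹A) = F(adj(C)A) + κ_C(A)` + κ-cancellation (HA6 `finsum_kappa_cancel`, finiteness HA5c `finite_kappa_support`). With
`C = M·g·S` the outer reversal `adj(C) = S⁻¹g⁻¹adj(M)` turns this into `Σ'_u [F(g⁻¹adj(M)u⁻¹γ) − F(g⁻¹adj(M)u⁻¹)]` (`manin_block_edge`).

References: [Merel1995Homologie] §2.1–2.2; [Manin1972] §1.5–1.7.
-/

set_option autoImplicit false

noncomputable section

-- justification: the `Summit.BirchSwinnertonDyer.BirchSwinnertonDyer.…` path repeats a component (route-file convention)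
set_option linter.dupNamespace false

open scoped Classical MatrixGroups

open CongruenceSubgroup Matrix.SpecialLinearGroup ModularGroup
open Literature.NumberTheory.EllipticCurves.ModularForms

namespace Summit.BirchSwinnertonDyer.BirchSwinnertonDyer.Theorems.ThetaLayerLambdaCongruenceAtTwo

section Reversal

/-- **Edge reversal for the triangle side**: `G₁(S⁻¹·Y) = 1 − G₁(Y)` for `Y ∈ SL₂(ℤ)`. [folklore] -/
theorem side_Sinv_mul (Y : SL(2, ℤ)) :
    (if (0 < (S⁻¹ * Y) 0 0 * (S⁻¹ * Y) 1 0 ∨ 0 < (S⁻¹ * Y) 0 1 * (S⁻¹ * Y) 1 1 ∨ 0 < ((S⁻¹ * Y) 0 0 + (S⁻¹ * Y) 0 1) * ((S⁻¹ * Y) 1 0 + (S⁻¹ * Y) 1 1)) then (1 : ℤ) else 0) =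
      1 - (if (0 < (Y) 0 0 * (Y) 1 0 ∨ 0 < (Y) 0 1 * (Y) 1 1 ∨ 0 < ((Y) 0 0 + (Y) 0 1) * ((Y) 1 0 + (Y) 1 1)) then (1 : ℤ) else 0) := by
  have hdet : Y 0 0 * Y 1 1 - Y 0 1 * Y 1 0 ≠ 0 := by
    have := Matrix.det_fin_two Y.1; rw [Y.2] at this; rw [← this]; exact one_ne_zero
  have e00 : (S⁻¹ * Y) 0 0 = Y 1 0 := by
    simp [Matrix.SpecialLinearGroup.coe_inv, ModularGroup.coe_S, Matrix.adjugate_fin_two, Matrix.mul_apply, Fin.sum_univ_two]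
  have e01 : (S⁻¹ * Y) 0 1 = Y 1 1 := by
    simp [Matrix.SpecialLinearGroup.coe_inv, ModularGroup.coe_S, Matrix.adjugate_fin_two, Matrix.mul_apply, Fin.sum_univ_two]
  have e10 : (S⁻¹ * Y) 1 0 = -(Y 0 0) := by
    simp [Matrix.SpecialLinearGroup.coe_inv, ModularGroup.coe_S, Matrix.adjugate_fin_two, Matrix.mul_apply, Fin.sum_univ_two]
  have e11 : (S⁻¹ * Y) 1 1 = -(Y 0 1) := by
    simp [Matrix.SpecialLinearGroup.coe_inv, ModularGroup.coe_S, Matrix.adjugate_fin_two, Matrix.mul_apply, Fin.sum_univ_two]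
  rw [← flagSide_coe_eq_side (S⁻¹ * Y), ← flagSide_coe_eq_side Y, e00, e01, e10, e11,
    ← flagSide_neg (Y 1 0) (Y 1 1) (-(Y 0 0)) (-(Y 0 1))]
  simp only [neg_neg]
  exact flagSide_S_mul (Y 0 0) (Y 0 1) (Y 1 0) (Y 1 1) hdet

/-- **Edge reversal for the flag side**: `F(S⁻¹·Z) = 1 − F(Z)` for an integer matrix `Z` with `det Z ≠ 0`. [folklore] -/
theorem flagSide_Sinv_mul (Z : Matrix (Fin 2) (Fin 2) ℤ) (hZ : Z.det ≠ 0) :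
    (if (0 < (((S⁻¹ : SL(2, ℤ)) : Matrix (Fin 2) (Fin 2) ℤ) * Z) 0 0 * (((S⁻¹ : SL(2, ℤ)) : Matrix (Fin 2) (Fin 2) ℤ) * Z) 1 0 ∨ ((((S⁻¹ : SL(2, ℤ)) : Matrix (Fin 2) (Fin 2) ℤ) * Z) 0 0 * (((S⁻¹ : SL(2, ℤ)) : Matrix (Fin 2) (Fin 2) ℤ) * Z) 1 0 = 0 ∧ (0 < ((((S⁻¹ : SL(2, ℤ)) : Matrix (Fin 2) (Fin 2) ℤ) * Z) 0 0 + 2 * (((S⁻¹ : SL(2, ℤ)) : Matrix (Fin 2) (Fin 2) ℤ) * Z) 0 1) * ((((S⁻¹ : SL(2, ℤ)) : Matrix (Fin 2) (Fin 2) ℤ) * Z) 1 0 + 2 * (((S⁻¹ : SL(2, ℤ)) : Matrix (Fin 2) (Fin 2) ℤ) * Z) 1 1) ∨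
          (((((S⁻¹ : SL(2, ℤ)) : Matrix (Fin 2) (Fin 2) ℤ) * Z) 0 0 + 2 * (((S⁻¹ : SL(2, ℤ)) : Matrix (Fin 2) (Fin 2) ℤ) * Z) 0 1) * ((((S⁻¹ : SL(2, ℤ)) : Matrix (Fin 2) (Fin 2) ℤ) * Z) 1 0 + 2 * (((S⁻¹ : SL(2, ℤ)) : Matrix (Fin 2) (Fin 2) ℤ) * Z) 1 1) = 0 ∧ 0 < (((S⁻¹ : SL(2, ℤ)) : Matrix (Fin 2) (Fin 2) ℤ) * Z) 0 0 * (((S⁻¹ : SL(2, ℤ)) : Matrix (Fin 2) (Fin 2) ℤ) * Z) 1 1 + (((S⁻¹ : SL(2, ℤ)) : Matrix (Fin 2) (Fin 2) ℤ) * Z) 0 1 * (((S⁻¹ : SL(2, ℤ)) : Matrix (Fin 2) (Fin 2) ℤ) * Z) 1 0)))) then (1 : ℤ) else 0) =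
      1 - (if (0 < (Z) 0 0 * (Z) 1 0 ∨ ((Z) 0 0 * (Z) 1 0 = 0 ∧ (0 < ((Z) 0 0 + 2 * (Z) 0 1) * ((Z) 1 0 + 2 * (Z) 1 1) ∨
          (((Z) 0 0 + 2 * (Z) 0 1) * ((Z) 1 0 + 2 * (Z) 1 1) = 0 ∧ 0 < (Z) 0 0 * (Z) 1 1 + (Z) 0 1 * (Z) 1 0)))) then (1 : ℤ) else 0) := by
  have hdet : Z 0 0 * Z 1 1 - Z 0 1 * Z 1 0 ≠ 0 := by rw [Matrix.det_fin_two] at hZ; exact hZ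
  have e00 : (((S⁻¹ : SL(2, ℤ)) : Matrix (Fin 2) (Fin 2) ℤ) * Z) 0 0 = Z 1 0 := by
    simp [Matrix.SpecialLinearGroup.coe_inv, ModularGroup.coe_S, Matrix.adjugate_fin_two, Matrix.mul_apply, Fin.sum_univ_two]
  have e01 : (((S⁻¹ : SL(2, ℤ)) : Matrix (Fin 2) (Fin 2) ℤ) * Z) 0 1 = Z 1 1 := by
    simp [Matrix.SpecialLinearGroup.coe_inv, ModularGroup.coe_S, Matrix.adjugate_fin_two, Matrix.mul_apply, Fin.sum_univ_two]
  have e10 : (((S⁻¹ : SL(2, ℤ)) : Matrix (Fin 2) (Fin 2) ℤ) * Z) 1 0 = -(Z 0 0) := by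
    simp [Matrix.SpecialLinearGroup.coe_inv, ModularGroup.coe_S, Matrix.adjugate_fin_two, Matrix.mul_apply, Fin.sum_univ_two]
  have e11 : (((S⁻¹ : SL(2, ℤ)) : Matrix (Fin 2) (Fin 2) ℤ) * Z) 1 1 = -(Z 0 1) := by
    simp [Matrix.SpecialLinearGroup.coe_inv, ModularGroup.coe_S, Matrix.adjugate_fin_two, Matrix.mul_apply, Fin.sum_univ_two]
  rw [e00, e01, e10, e11, ← flagSide_neg (Z 1 0) (Z 1 1) (-(Z 0 0)) (-(Z 0 1))]
  simp only [neg_neg]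
  exact flagSide_S_mul (Z 0 0) (Z 0 1) (Z 1 0) (Z 1 1) hdet

end Reversal

section ManinBlock

variable {N : ℕ}

/-- **One re-expanded block (Manin side).** With the re-expansion data of `C = g₀·(u v; 0 w)` (`exists_reexpansion`) and a dual walk `D`
from the base triangle to the triangle of `γ ∈ Γ₀(N)`:
`2·Σ_{f∈P} vec(D)((g₀fS)⁻¹Γ₀) = −Σ'_{u∈Γ₀(N)} [F(adj(C)·u⁻¹·γ) − F(adj(C)·u⁻¹)]`.
(Side formula for the steps `g₀fS`; `G₁(S⁻¹Y) = 1 − G₁(Y)`; `Σ_f G₁((g₀f)⁻¹A) = F(adj(C)A) + κ_C(A)`; `Σ'_u κ(u⁻¹γ) − κ(u⁻¹) = 0`.)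
[cite: Merel1995Homologie, §2.1–2.2] [cite: Manin1972, §1.5] -/
theorem manin_block (γ : Gamma0 N) (D : List SL(2, ℤ))
    (hD : ∀ {A : Type} [AddCommGroup A] (G : SL(2, ℤ) → A),
      (∀ x, G (x * (S * T⁻¹)) = G x) → (∀ x, G (-x) = G x) → (D.map fun h ↦ G h - G (h * S)).sum = G (γ : SL(2, ℤ)) - G 1)
    (g₀ : SL(2, ℤ)) (u v w d : ℤ) (m : ℕ) (x y : ℕ → ℤ) (P : List SL(2, ℤ))
    (hu : 0 < u) (hd : 0 < d) (hm : 1 ≤ m) (hx0 : x 0 = 1) (hy0 : y 0 = 0)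
    (hypos : ∀ j, 1 ≤ j → j ≤ m → 0 < y j) (hdet : ∀ j, j < m → x j * y (j + 1) - x (j + 1) * y j = 1)
    (hvd : v = d * x m) (hwd : w = d * y m) (hlen : P.length = m)
    (hget : ∀ (j : ℕ) (hj : j < P.length), ((P[j] : SL(2, ℤ)) : Matrix (Fin 2) (Fin 2) ℤ) = !![x j, x (j + 1); y j, y (j + 1)]) :
    2 * (P.map fun f ↦ (D.map fun h ↦ (Pi.single ((h⁻¹ : SL(2, ℤ)) : Gamma0Coset N) (1 : ℤ) -
          Pi.single (((h * S)⁻¹ : SL(2, ℤ)) : Gamma0Coset N) 1 : Gamma0Coset N → ℤ)).sum (((g₀ * f * S)⁻¹ : SL(2, ℤ)) : Gamma0Coset N)).sum =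
      -∑ᶠ uu : Gamma0 N,
        ((if (0 < (((g₀ : Matrix (Fin 2) (Fin 2) ℤ) * !![u, v; 0, w]).adjugate * (((uu⁻¹ : Gamma0 N) : SL(2, ℤ)) : Matrix (Fin 2) (Fin 2) ℤ) * ((γ : SL(2, ℤ)) : Matrix (Fin 2) (Fin 2) ℤ)) 0 0 * (((g₀ : Matrix (Fin 2) (Fin 2) ℤ) * !![u, v; 0, w]).adjugate * (((uu⁻¹ : Gamma0 N) : SL(2, ℤ)) : Matrix (Fin 2) (Fin 2) ℤ) * ((γ : SL(2, ℤ)) : Matrix (Fin 2) (Fin 2) ℤ)) 1 0 ∨ ((((g₀ : Matrix (Fin 2) (Fin 2) ℤ) * !![u, v; 0, w]).adjugate * (((uu⁻¹ : Gamma0 N) : SL(2, ℤ)) : Matrix (Fin 2) (Fin 2) ℤ) * ((γ : SL(2, ℤ)) : Matrix (Fin 2) (Fin 2) ℤ)) 0 0 * (((g₀ : Matrix (Fin 2) (Fin 2) ℤ) * !![u, v; 0, w]).adjugate * (((uu⁻¹ : Gamma0 N) : SL(2, ℤ)) : Matrix (Fin 2) (Fin 2) ℤ) * ((γ : SL(2,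 ℤ)) : Matrix (Fin 2) (Fin 2) ℤ)) 1 0 = 0 ∧ (0 < ((((g₀ : Matrix (Fin 2) (Fin 2) ℤ) * !![u, v; 0, w]).adjugate * (((uu⁻¹ : Gamma0 N) : SL(2, ℤ)) : Matrix (Fin 2) (Fin 2) ℤ) * ((γ : SL(2, ℤ)) : Matrix (Fin 2) (Fin 2) ℤ)) 0 0 + 2 * (((g₀ : Matrix (Fin 2) (Fin 2) ℤ) * !![u, v; 0, w]).adjugate * (((uu⁻¹ : Gamma0 N) : SL(2, ℤ)) : Matrix (Fin 2) (Fin 2) ℤ) * ((γ : SL(2, ℤ)) : Matrix (Fin 2) (Fin 2) ℤ)) 0 1) * ((((g₀ : Matrix (Fin 2) (Fin 2) ℤ) * !![u, v; 0, w]).adjugate * (((uu⁻¹ : Gamma0 N) : SL(2, ℤ)) : Matrix (Fin 2) (Fin 2) ℤ) * ((γ : SL(2, ℤ)) : Matrix (Fin 2) (Fin 2) ℤ)) 1 0 + 2 * (((g₀ : Matrix (Fin 2) (Fin 2) ℤ) * !![u, v; 0, w]).adjugate * (((uu⁻¹ : Gamma0 N) : SL(2, ℤ)) : Matrix (Fin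 2) (Fin 2) ℤ) * ((γ : SL(2, ℤ)) : Matrix (Fin 2) (Fin 2) ℤ)) 1 1) ∨
          (((((g₀ : Matrix (Fin 2) (Fin 2) ℤ) * !![u, v; 0, w]).adjugate * (((uu⁻¹ : Gamma0 N) : SL(2, ℤ)) : Matrix (Fin 2) (Fin 2) ℤ) * ((γ : SL(2, ℤ)) : Matrix (Fin 2) (Fin 2) ℤ)) 0 0 + 2 * (((g₀ : Matrix (Fin 2) (Fin 2) ℤ) * !![u, v; 0, w]).adjugate * (((uu⁻¹ : Gamma0 N) : SL(2, ℤ)) : Matrix (Fin 2) (Fin 2) ℤ) * ((γ : SL(2, ℤ)) : Matrix (Fin 2) (Fin 2) ℤ)) 0 1) * ((((g₀ : Matrix (Fin 2) (Fin 2) ℤ) * !![u, v; 0, w]).adjugate * (((uu⁻¹ : Gamma0 N) : SL(2, ℤ)) : Matrix (Fin 2) (Fin 2) ℤ) * ((γ : SL(2, ℤ)) : Matrix (Fin 2) (Fin 2) ℤ)) 1 0 + 2 * (((g₀ : Matrix (Fin 2) (Fin 2) ℤ) * !![u, v; 0, w]).adjugate * (((uu⁻¹ : Gamma0 N) : SL(2,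 ℤ)) : Matrix (Fin 2) (Fin 2) ℤ) * ((γ : SL(2, ℤ)) : Matrix (Fin 2) (Fin 2) ℤ)) 1 1) = 0 ∧ 0 < (((g₀ : Matrix (Fin 2) (Fin 2) ℤ) * !![u, v; 0, w]).adjugate * (((uu⁻¹ : Gamma0 N) : SL(2, ℤ)) : Matrix (Fin 2) (Fin 2) ℤ) * ((γ : SL(2, ℤ)) : Matrix (Fin 2) (Fin 2) ℤ)) 0 0 * (((g₀ : Matrix (Fin 2) (Fin 2) ℤ) * !![u, v; 0, w]).adjugate * (((uu⁻¹ : Gamma0 N) : SL(2, ℤ)) : Matrix (Fin 2) (Fin 2) ℤ) * ((γ : SL(2, ℤ)) : Matrix (Fin 2) (Fin 2) ℤ)) 1 1 + (((g₀ : Matrix (Fin 2) (Fin 2) ℤ) * !![u, v; 0, w]).adjugate * (((uu⁻¹ : Gamma0 N) : SL(2, ℤ)) : Matrix (Fin 2) (Fin 2) ℤ) * ((γ : SL(2, ℤ)) : Matrix (Fin 2) (Fin 2) ℤ)) 0 1 * (((g₀ : Matrix (Fin 2) (Fin 2) ℤ) * !![u, v; 0, w]).adjugate * (((uu⁻¹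 : Gamma0 N) : SL(2, ℤ)) : Matrix (Fin 2) (Fin 2) ℤ) * ((γ : SL(2, ℤ)) : Matrix (Fin 2) (Fin 2) ℤ)) 1 0)))) then (1 : ℤ) else 0) -
         (if (0 < (((g₀ : Matrix (Fin 2) (Fin 2) ℤ) * !![u, v; 0, w]).adjugate * (((uu⁻¹ : Gamma0 N) : SL(2, ℤ)) : Matrix (Fin 2) (Fin 2) ℤ)) 0 0 * (((g₀ : Matrix (Fin 2) (Fin 2) ℤ) * !![u, v; 0, w]).adjugate * (((uu⁻¹ : Gamma0 N) : SL(2, ℤ)) : Matrix (Fin 2) (Fin 2) ℤ)) 1 0 ∨ ((((g₀ : Matrix (Fin 2) (Fin 2) ℤ) * !![u, v; 0, w]).adjugate * (((uu⁻¹ : Gamma0 N) : SL(2, ℤ)) : Matrix (Fin 2) (Fin 2) ℤ)) 0 0 * (((g₀ : Matrix (Fin 2) (Fin 2) ℤ) * !![u, v; 0, w]).adjugate * (((uu⁻¹ : Gamma0 N) : SL(2, ℤ)) : Matrix (Fin 2) (Fin 2) ℤ)) 1 0 = 0 ∧ (0 < ((((g₀ : Matrix (Fin 2) (Fin 2) ℤ)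 * !![u, v; 0, w]).adjugate * (((uu⁻¹ : Gamma0 N) : SL(2, ℤ)) : Matrix (Fin 2) (Fin 2) ℤ)) 0 0 + 2 * (((g₀ : Matrix (Fin 2) (Fin 2) ℤ) * !![u, v; 0, w]).adjugate * (((uu⁻¹ : Gamma0 N) : SL(2, ℤ)) : Matrix (Fin 2) (Fin 2) ℤ)) 0 1) * ((((g₀ : Matrix (Fin 2) (Fin 2) ℤ) * !![u, v; 0, w]).adjugate * (((uu⁻¹ : Gamma0 N) : SL(2, ℤ)) : Matrix (Fin 2) (Fin 2) ℤ)) 1 0 + 2 * (((g₀ : Matrix (Fin 2) (Fin 2) ℤ) * !![u, v; 0, w]).adjugate * (((uu⁻¹ : Gamma0 N) : SL(2, ℤ)) : Matrix (Fin 2) (Fin 2) ℤ)) 1 1) ∨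
          (((((g₀ : Matrix (Fin 2) (Fin 2) ℤ) * !![u, v; 0, w]).adjugate * (((uu⁻¹ : Gamma0 N) : SL(2, ℤ)) : Matrix (Fin 2) (Fin 2) ℤ)) 0 0 + 2 * (((g₀ : Matrix (Fin 2) (Fin 2) ℤ) * !![u, v; 0, w]).adjugate * (((uu⁻¹ : Gamma0 N) : SL(2, ℤ)) : Matrix (Fin 2) (Fin 2) ℤ)) 0 1) * ((((g₀ : Matrix (Fin 2) (Fin 2) ℤ) * !![u, v; 0, w]).adjugate * (((uu⁻¹ : Gamma0 N) : SL(2, ℤ)) : Matrix (Fin 2) (Fin 2) ℤ)) 1 0 + 2 * (((g₀ : Matrix (Fin 2) (Fin 2) ℤ) * !![u, v; 0, w]).adjugate * (((uu⁻¹ : Gamma0 N) : SL(2, ℤ)) : Matrix (Fin 2) (Fin 2) ℤ)) 1 1) = 0 ∧ 0 < (((g₀ : Matrix (Fin 2) (Fin 2) ℤ) * !![u, v; 0, w]).adjugate * (((uu⁻¹ : Gamma0 N) : SL(2, ℤ)) : Matrix (Fin 2) (Fin 2) ℤ)) 0 0 * (((g₀ : Matrix (Fin 2) (Fin 2) ℤ)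 * !![u, v; 0, w]).adjugate * (((uu⁻¹ : Gamma0 N) : SL(2, ℤ)) : Matrix (Fin 2) (Fin 2) ℤ)) 1 1 + (((g₀ : Matrix (Fin 2) (Fin 2) ℤ) * !![u, v; 0, w]).adjugate * (((uu⁻¹ : Gamma0 N) : SL(2, ℤ)) : Matrix (Fin 2) (Fin 2) ℤ)) 0 1 * (((g₀ : Matrix (Fin 2) (Fin 2) ℤ) * !![u, v; 0, w]).adjugate * (((uu⁻¹ : Gamma0 N) : SL(2, ℤ)) : Matrix (Fin 2) (Fin 2) ℤ)) 1 0)))) then (1 : ℤ) else 0)) := by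
  -- κ (kept opaque) and its finite support (HA5c)
  obtain ⟨κ, hκ⟩ : ∃ κ : SL(2, ℤ) → ℤ, ∀ A, κ A = ((P.map fun f ↦ g₀ * f).map fun f ↦ (if (0 < (f⁻¹ * A) 0 0 * (f⁻¹ * A) 1 0 ∨ 0 < (f⁻¹ * A) 0 1 * (f⁻¹ * A) 1 1 ∨ 0 < ((f⁻¹ * A) 0 0 + (f⁻¹ * A) 0 1) * ((f⁻¹ * A) 1 0 + (f⁻¹ * A) 1 1)) then (1 : ℤ) else 0)).sum -
        (if (0 < (((g₀ : Matrix (Fin 2) (Fin 2) ℤ) * !![u, v; 0, w]).adjugate * (A : Matrix (Fin 2) (Fin 2) ℤ)) 0 0 * (((g₀ : Matrix (Fin 2) (Fin 2) ℤ) * !![u, v; 0, w]).adjugate * (A : Matrix (Fin 2) (Fin 2) ℤ)) 1 0 ∨ ((((g₀ : Matrix (Fin 2) (Fin 2) ℤ) * !![u, v; 0, w]).adjugate * (A : Matrix (Fin 2) (Fin 2) ℤ)) 0 0 * (((g₀ : Matrix (Fin 2) (Fin 2) ℤ) * !![u, v; 0, w]).adjugate * (A : Matrix (Fin 2) (Fin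 2) ℤ)) 1 0 = 0 ∧ (0 < ((((g₀ : Matrix (Fin 2) (Fin 2) ℤ) * !![u, v; 0, w]).adjugate * (A : Matrix (Fin 2) (Fin 2) ℤ)) 0 0 + 2 * (((g₀ : Matrix (Fin 2) (Fin 2) ℤ) * !![u, v; 0, w]).adjugate * (A : Matrix (Fin 2) (Fin 2) ℤ)) 0 1) * ((((g₀ : Matrix (Fin 2) (Fin 2) ℤ) * !![u, v; 0, w]).adjugate * (A : Matrix (Fin 2) (Fin 2) ℤ)) 1 0 + 2 * (((g₀ : Matrix (Fin 2) (Fin 2) ℤ) * !![u, v; 0, w]).adjugate * (A : Matrix (Fin 2) (Fin 2) ℤ)) 1 1) ∨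
          (((((g₀ : Matrix (Fin 2) (Fin 2) ℤ) * !![u, v; 0, w]).adjugate * (A : Matrix (Fin 2) (Fin 2) ℤ)) 0 0 + 2 * (((g₀ : Matrix (Fin 2) (Fin 2) ℤ) * !![u, v; 0, w]).adjugate * (A : Matrix (Fin 2) (Fin 2) ℤ)) 0 1) * ((((g₀ : Matrix (Fin 2) (Fin 2) ℤ) * !![u, v; 0, w]).adjugate * (A : Matrix (Fin 2) (Fin 2) ℤ)) 1 0 + 2 * (((g₀ : Matrix (Fin 2) (Fin 2) ℤ) * !![u, v; 0, w]).adjugate * (A : Matrix (Fin 2) (Fin 2) ℤ)) 1 1) = 0 ∧ 0 < (((g₀ : Matrix (Fin 2) (Fin 2) ℤ) * !![u, v; 0, w]).adjugate * (A : Matrix (Fin 2) (Fin 2) ℤ)) 0 0 * (((g₀ : Matrix (Fin 2) (Fin 2) ℤ) * !![u, v; 0, w]).adjugate * (A : Matrix (Fin 2) (Fin 2) ℤ)) 1 1 + (((g₀ : Matrix (Fin 2) (Fin 2) ℤ) * !![u, v; 0, w]).adjugate * (A : Matrix (Fin 2) (Fin 2) ℤ)) 0 1 * (((g₀ : Matrix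 (Fin 2) (Fin 2) ℤ) * !![u, v; 0, w]).adjugate * (A : Matrix (Fin 2) (Fin 2) ℤ)) 1 0)))) then (1 : ℤ) else 0) := ⟨_, fun A ↦ rfl⟩
  have hκfin : (Function.support κ).Finite := by
    have h := finite_kappa_support g₀ u v w d m x y P hu hd hm hx0 hy0 hypos hdet hvd hwd hlen hget
    refine h.subset fun A hA ↦ ?_
    rw [Function.mem_support, hκ] at hA
    exact hA
  -- a small list identity
  have lsum : ∀ (l : List SL(2, ℤ)) (a b : SL(2, ℤ) → ℤ), (l.map fun f ↦ -(a f - b f)).sum = -((l.map a).sum - (l.map b).sum) := by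
    intro l a b; induction l with
    | nil => simp
    | cons f l ih => simp only [List.map_cons, List.sum_cons, ih]; ring
  -- (b1)+(b2): one step `g₀ f S`, side formula and edge reversal
  have hstep : ∀ f : SL(2, ℤ),
      2 * (D.map fun h ↦ (Pi.single ((h⁻¹ : SL(2, ℤ)) : Gamma0Coset N) (1 : ℤ) - Pi.single (((h * S)⁻¹ : SL(2, ℤ)) : Gamma0Coset N) 1 : Gamma0Coset N → ℤ)).sum (((g₀ * f * S)⁻¹ : SL(2, ℤ)) : Gamma0Coset N) =
        ∑ᶠ uu : Gamma0 N, -((if (0 < (((uu : SL(2, ℤ)) * (g₀ * f))⁻¹ * (γ : SL(2, ℤ))) 0 0 * (((uu : SL(2, ℤ)) * (g₀ * f))⁻¹ * (γ : SL(2, ℤ))) 1 0 ∨ 0 < (((uu : SL(2, ℤ)) * (g₀ * f))⁻¹ * (γ : SL(2, ℤ))) 0 1 * (((uu : SL(2, ℤ)) * (g₀ * f))⁻¹ * (γ : SL(2, ℤ))) 1 1 ∨ 0 < ((((uu : SL(2, ℤ)) * (g₀ * f))⁻¹ * (γ : SL(2, ℤ))) 0 0 + (((uu : SL(2, ℤ))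 * (g₀ * f))⁻¹ * (γ : SL(2, ℤ))) 0 1) * ((((uu : SL(2, ℤ)) * (g₀ * f))⁻¹ * (γ : SL(2, ℤ))) 1 0 + (((uu : SL(2, ℤ)) * (g₀ * f))⁻¹ * (γ : SL(2, ℤ))) 1 1)) then (1 : ℤ) else 0) -
                             (if (0 < (((uu : SL(2, ℤ)) * (g₀ * f))⁻¹ * 1) 0 0 * (((uu : SL(2, ℤ)) * (g₀ * f))⁻¹ * 1) 1 0 ∨ 0 < (((uu : SL(2, ℤ)) * (g₀ * f))⁻¹ * 1) 0 1 * (((uu : SL(2, ℤ)) * (g₀ * f))⁻¹ * 1) 1 1 ∨ 0 < ((((uu : SL(2, ℤ)) * (g₀ * f))⁻¹ * 1) 0 0 + (((uu : SL(2, ℤ)) * (g₀ * f))⁻¹ * 1) 0 1) * ((((uu : SL(2, ℤ)) * (g₀ * f))⁻¹ * 1) 1 0 + (((uu : SL(2, ℤ)) * (g₀ * f))⁻¹ * 1) 1 1)) then (1 : ℤ) else 0)) := by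
    intro f
    rw [two_mul_dualChainVec_eq_finsum 1 (γ : SL(2, ℤ)) D hD (g₀ * f * S)]
    refine finsum_congr fun uu ↦ ?_
    have e : ∀ k : SL(2, ℤ), ((uu : SL(2, ℤ)) * (g₀ * f * S))⁻¹ * k = S⁻¹ * (((uu : SL(2, ℤ)) * (g₀ * f))⁻¹ * k) := by
      intro k; simp only [mul_inv_rev, mul_assoc]
    rw [e, e, side_Sinv_mul, side_Sinv_mul]
    ring
  -- (b3): swap the list sum with the finsum
  have hfin : ∀ f : SL(2, ℤ), (Function.support fun uu : Gamma0 N ↦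
      -((if (0 < (((uu : SL(2, ℤ)) * (g₀ * f))⁻¹ * (γ : SL(2, ℤ))) 0 0 * (((uu : SL(2, ℤ)) * (g₀ * f))⁻¹ * (γ : SL(2, ℤ))) 1 0 ∨ 0 < (((uu : SL(2, ℤ)) * (g₀ * f))⁻¹ * (γ : SL(2, ℤ))) 0 1 * (((uu : SL(2, ℤ)) * (g₀ * f))⁻¹ * (γ : SL(2, ℤ))) 1 1 ∨ 0 < ((((uu : SL(2, ℤ)) * (g₀ * f))⁻¹ * (γ : SL(2, ℤ))) 0 0 + (((uu : SL(2, ℤ)) * (g₀ * f))⁻¹ * (γ : SL(2, ℤ))) 0 1) * ((((uu : SL(2, ℤ)) * (g₀ * f))⁻¹ * (γ : SL(2, ℤ))) 1 0 + (((uu : SL(2, ℤ)) * (g₀ * f))⁻¹ * (γ : SL(2, ℤ))) 1 1)) then (1 : ℤ) else 0) -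
        (if (0 < (((uu : SL(2, ℤ)) * (g₀ * f))⁻¹ * 1) 0 0 * (((uu : SL(2, ℤ)) * (g₀ * f))⁻¹ * 1) 1 0 ∨ 0 < (((uu : SL(2, ℤ)) * (g₀ * f))⁻¹ * 1) 0 1 * (((uu : SL(2, ℤ)) * (g₀ * f))⁻¹ * 1) 1 1 ∨ 0 < ((((uu : SL(2, ℤ)) * (g₀ * f))⁻¹ * 1) 0 0 + (((uu : SL(2, ℤ)) * (g₀ * f))⁻¹ * 1) 0 1) * ((((uu : SL(2, ℤ)) * (g₀ * f))⁻¹ * 1) 1 0 + (((uu : SL(2, ℤ)) * (g₀ * f))⁻¹ * 1) 1 1)) then (1 : ℤ) else 0))).Finite :=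
    fun f ↦ (finite_support_sideDiff 1 (γ : SL(2, ℤ)) D hD (g₀ * f)).subset fun uu huu ↦ neg_ne_zero.mp huu
  obtain ⟨htotfin, hswap⟩ := finsum_list_sum_swap (fun f (uu : Gamma0 N) ↦
      -((if (0 < (((uu : SL(2, ℤ)) * (g₀ * f))⁻¹ * (γ : SL(2, ℤ))) 0 0 * (((uu : SL(2, ℤ)) * (g₀ * f))⁻¹ * (γ : SL(2, ℤ))) 1 0 ∨ 0 < (((uu : SL(2, ℤ)) * (g₀ * f))⁻¹ * (γ : SL(2, ℤ))) 0 1 * (((uu : SL(2, ℤ)) * (g₀ * f))⁻¹ * (γ : SL(2, ℤ))) 1 1 ∨ 0 < ((((uu : SL(2, ℤ)) * (g₀ * f))⁻¹ * (γ : SL(2, ℤ))) 0 0 + (((uu : SL(2, ℤ)) * (g₀ * f))⁻¹ * (γ : SL(2, ℤ))) 0 1) * ((((uu : SL(2, ℤ)) * (g₀ * f))⁻¹ * (γ : SL(2, ℤ))) 1 0 + (((uu : SL(2, ℤ)) * (g₀ * f))⁻¹ * (γ : SL(2, ℤ))) 1 1)) then (1 : ℤ) else 0) -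
        (if (0 < (((uu : SL(2, ℤ)) * (g₀ * f))⁻¹ * 1) 0 0 * (((uu : SL(2, ℤ)) * (g₀ * f))⁻¹ * 1) 1 0 ∨ 0 < (((uu : SL(2, ℤ)) * (g₀ * f))⁻¹ * 1) 0 1 * (((uu : SL(2, ℤ)) * (g₀ * f))⁻¹ * 1) 1 1 ∨ 0 < ((((uu : SL(2, ℤ)) * (g₀ * f))⁻¹ * 1) 0 0 + (((uu : SL(2, ℤ)) * (g₀ * f))⁻¹ * 1) 0 1) * ((((uu : SL(2, ℤ)) * (g₀ * f))⁻¹ * 1) 1 0 + (((uu : SL(2, ℤ)) * (g₀ * f))⁻¹ * 1) 1 1)) then (1 : ℤ) else 0))) hfin P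
  rw [← List.sum_map_mul_left, List.map_congr_left (fun f _ ↦ hstep f), ← hswap]
  -- (b4): for every `k`, the block sum of `G₁((u g₀ f)⁻¹ k)` is `κ(u⁻¹k) + F(adj C · u⁻¹k)`
  have hsumA : ∀ (uu : Gamma0 N) (k : SL(2, ℤ)), (P.map fun f ↦ (if (0 < (((uu : SL(2, ℤ)) * (g₀ * f))⁻¹ * k) 0 0 * (((uu : SL(2, ℤ)) * (g₀ * f))⁻¹ * k) 1 0 ∨ 0 < (((uu : SL(2, ℤ)) * (g₀ * f))⁻¹ * k) 0 1 * (((uu : SL(2, ℤ)) * (g₀ * f))⁻¹ * k) 1 1 ∨ 0 < ((((uu : SL(2, ℤ)) * (g₀ * f))⁻¹ * k) 0 0 + (((uu : SL(2, ℤ)) * (g₀ * f))⁻¹ * k) 0 1) * ((((uu : SL(2, ℤ)) * (g₀ * f))⁻¹ * k) 1 0 + (((uu : SL(2, ℤ)) * (g₀ * f))⁻¹ * k) 1 1)) then (1 : ℤ) else 0)).sum =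
      κ (((uu⁻¹ : Gamma0 N) : SL(2, ℤ)) * k) + (if (0 < (((g₀ : Matrix (Fin 2) (Fin 2) ℤ) * !![u, v; 0, w]).adjugate * ((((uu⁻¹ : Gamma0 N) : SL(2, ℤ)) * k : SL(2, ℤ)) : Matrix (Fin 2) (Fin 2) ℤ)) 0 0 * (((g₀ : Matrix (Fin 2) (Fin 2) ℤ) * !![u, v; 0, w]).adjugate * ((((uu⁻¹ : Gamma0 N) : SL(2, ℤ)) * k : SL(2, ℤ)) : Matrix (Fin 2) (Fin 2) ℤ)) 1 0 ∨ ((((g₀ : Matrix (Fin 2) (Fin 2) ℤ) * !![u, v; 0, w]).adjugate * ((((uu⁻¹ : Gamma0 N) : SL(2, ℤ)) * k : SL(2, ℤ)) : Matrix (Fin 2) (Fin 2) ℤ)) 0 0 * (((g₀ : Matrix (Fin 2) (Fin 2) ℤ) * !![u, v; 0, w]).adjugate * ((((uu⁻¹ : Gamma0 N) : SL(2, ℤ)) * k : SL(2, ℤ)) : Matrix (Fin 2) (Fin 2) ℤ)) 1 0 = 0 ∧ (0 < ((((g₀ : Matrix (Fin 2) (Fin 2) ℤ) * !![u, v; 0,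 w]).adjugate * ((((uu⁻¹ : Gamma0 N) : SL(2, ℤ)) * k : SL(2, ℤ)) : Matrix (Fin 2) (Fin 2) ℤ)) 0 0 + 2 * (((g₀ : Matrix (Fin 2) (Fin 2) ℤ) * !![u, v; 0, w]).adjugate * ((((uu⁻¹ : Gamma0 N) : SL(2, ℤ)) * k : SL(2, ℤ)) : Matrix (Fin 2) (Fin 2) ℤ)) 0 1) * ((((g₀ : Matrix (Fin 2) (Fin 2) ℤ) * !![u, v; 0, w]).adjugate * ((((uu⁻¹ : Gamma0 N) : SL(2, ℤ)) * k : SL(2, ℤ)) : Matrix (Fin 2) (Fin 2) ℤ)) 1 0 + 2 * (((g₀ : Matrix (Fin 2) (Fin 2) ℤ) * !![u, v; 0, w]).adjugate * ((((uu⁻¹ : Gamma0 N) : SL(2, ℤ)) * k : SL(2, ℤ)) : Matrix (Fin 2) (Fin 2) ℤ)) 1 1) ∨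
          (((((g₀ : Matrix (Fin 2) (Fin 2) ℤ) * !![u, v; 0, w]).adjugate * ((((uu⁻¹ : Gamma0 N) : SL(2, ℤ)) * k : SL(2, ℤ)) : Matrix (Fin 2) (Fin 2) ℤ)) 0 0 + 2 * (((g₀ : Matrix (Fin 2) (Fin 2) ℤ) * !![u, v; 0, w]).adjugate * ((((uu⁻¹ : Gamma0 N) : SL(2, ℤ)) * k : SL(2, ℤ)) : Matrix (Fin 2) (Fin 2) ℤ)) 0 1) * ((((g₀ : Matrix (Fin 2) (Fin 2) ℤ) * !![u, v; 0, w]).adjugate * ((((uu⁻¹ : Gamma0 N) : SL(2, ℤ)) * k : SL(2, ℤ)) : Matrix (Fin 2) (Fin 2) ℤ)) 1 0 + 2 * (((g₀ : Matrix (Fin 2) (Fin 2) ℤ) * !![u, v; 0, w]).adjugate * ((((uu⁻¹ : Gamma0 N) : SL(2, ℤ)) * k : SL(2, ℤ)) : Matrix (Fin 2) (Fin 2) ℤ)) 1 1) = 0 ∧ 0 < (((g₀ : Matrix (Fin 2) (Fin 2) ℤ) * !![u, v; 0, w]).adjugate * ((((uu⁻¹ : Gamma0 N) : SL(2, ℤ))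 * k : SL(2, ℤ)) : Matrix (Fin 2) (Fin 2) ℤ)) 0 0 * (((g₀ : Matrix (Fin 2) (Fin 2) ℤ) * !![u, v; 0, w]).adjugate * ((((uu⁻¹ : Gamma0 N) : SL(2, ℤ)) * k : SL(2, ℤ)) : Matrix (Fin 2) (Fin 2) ℤ)) 1 1 + (((g₀ : Matrix (Fin 2) (Fin 2) ℤ) * !![u, v; 0, w]).adjugate * ((((uu⁻¹ : Gamma0 N) : SL(2, ℤ)) * k : SL(2, ℤ)) : Matrix (Fin 2) (Fin 2) ℤ)) 0 1 * (((g₀ : Matrix (Fin 2) (Fin 2) ℤ) * !![u, v; 0, w]).adjugate * ((((uu⁻¹ : Gamma0 N) : SL(2, ℤ)) * k : SL(2, ℤ)) : Matrix (Fin 2) (Fin 2) ℤ)) 1 0)))) then (1 : ℤ) else 0) := by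
    intro uu k
    rw [hκ, sub_add_cancel, List.map_map]
    refine congrArg List.sum (List.map_congr_left fun f _ ↦ ?_)
    have e : ((uu : SL(2, ℤ)) * (g₀ * f))⁻¹ * k = (g₀ * f)⁻¹ * (((uu⁻¹ : Gamma0 N) : SL(2, ℤ)) * k) := by
      rw [Subgroup.coe_inv, mul_inv_rev, mul_assoc]
    rw [Function.comp_apply, e]
  have hpt : ∀ uu : Gamma0 N, (P.map fun f ↦
      -((if (0 < (((uu : SL(2, ℤ)) * (g₀ * f))⁻¹ * (γ : SL(2, ℤ))) 0 0 * (((uu : SL(2, ℤ)) * (g₀ * f))⁻¹ * (γ : SL(2, ℤ))) 1 0 ∨ 0 < (((uu : SL(2, ℤ)) * (g₀ * f))⁻¹ * (γ : SL(2, ℤ))) 0 1 * (((uu : SL(2, ℤ)) * (g₀ * f))⁻¹ * (γ : SL(2, ℤ))) 1 1 ∨ 0 < ((((uu : SL(2, ℤ)) * (g₀ * f))⁻¹ * (γ : SL(2, ℤ))) 0 0 + (((uu : SL(2, ℤ)) * (g₀ * f))⁻¹ * (γ : SL(2, ℤ))) 0 1) * ((((uu : SL(2, ℤ)) * (g₀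 * f))⁻¹ * (γ : SL(2, ℤ))) 1 0 + (((uu : SL(2, ℤ)) * (g₀ * f))⁻¹ * (γ : SL(2, ℤ))) 1 1)) then (1 : ℤ) else 0) -
        (if (0 < (((uu : SL(2, ℤ)) * (g₀ * f))⁻¹ * 1) 0 0 * (((uu : SL(2, ℤ)) * (g₀ * f))⁻¹ * 1) 1 0 ∨ 0 < (((uu : SL(2, ℤ)) * (g₀ * f))⁻¹ * 1) 0 1 * (((uu : SL(2, ℤ)) * (g₀ * f))⁻¹ * 1) 1 1 ∨ 0 < ((((uu : SL(2, ℤ)) * (g₀ * f))⁻¹ * 1) 0 0 + (((uu : SL(2, ℤ)) * (g₀ * f))⁻¹ * 1) 0 1) * ((((uu : SL(2, ℤ)) * (g₀ * f))⁻¹ * 1) 1 0 + (((uu : SL(2, ℤ)) * (g₀ * f))⁻¹ * 1) 1 1)) then (1 : ℤ) else 0))).sum =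
      -(κ (((uu⁻¹ : Gamma0 N) : SL(2, ℤ)) * γ) - κ ((uu⁻¹ : Gamma0 N) : SL(2, ℤ))) -
        ((if (0 < (((g₀ : Matrix (Fin 2) (Fin 2) ℤ) * !![u, v; 0, w]).adjugate * (((uu⁻¹ : Gamma0 N) : SL(2, ℤ)) : Matrix (Fin 2) (Fin 2) ℤ) * ((γ : SL(2, ℤ)) : Matrix (Fin 2) (Fin 2) ℤ)) 0 0 * (((g₀ : Matrix (Fin 2) (Fin 2) ℤ) * !![u, v; 0, w]).adjugate * (((uu⁻¹ : Gamma0 N) : SL(2, ℤ)) : Matrix (Fin 2) (Fin 2) ℤ) * ((γ : SL(2, ℤ)) : Matrix (Fin 2) (Fin 2) ℤ)) 1 0 ∨ ((((g₀ : Matrix (Fin 2) (Fin 2) ℤ) * !![u, v; 0, w]).adjugate * (((uu⁻¹ : Gamma0 N) : SL(2, ℤ)) : Matrix (Fin 2) (Fin 2) ℤ) * ((γ : SL(2, ℤ)) : Matrix (Fin 2) (Fin 2) ℤ)) 0 0 * (((g₀ : Matrix (Fin 2) (Fin 2) ℤ) * !![u, v; 0, w]).adjugate * (((uu⁻¹ :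 Gamma0 N) : SL(2, ℤ)) : Matrix (Fin 2) (Fin 2) ℤ) * ((γ : SL(2, ℤ)) : Matrix (Fin 2) (Fin 2) ℤ)) 1 0 = 0 ∧ (0 < ((((g₀ : Matrix (Fin 2) (Fin 2) ℤ) * !![u, v; 0, w]).adjugate * (((uu⁻¹ : Gamma0 N) : SL(2, ℤ)) : Matrix (Fin 2) (Fin 2) ℤ) * ((γ : SL(2, ℤ)) : Matrix (Fin 2) (Fin 2) ℤ)) 0 0 + 2 * (((g₀ : Matrix (Fin 2) (Fin 2) ℤ) * !![u, v; 0, w]).adjugate * (((uu⁻¹ : Gamma0 N) : SL(2, ℤ)) : Matrix (Fin 2) (Fin 2) ℤ) * ((γ : SL(2, ℤ)) : Matrix (Fin 2) (Fin 2) ℤ)) 0 1) * ((((g₀ : Matrix (Fin 2) (Fin 2) ℤ) * !![u, v; 0, w]).adjugate * (((uu⁻¹ : Gamma0 N) : SL(2, ℤ)) : Matrix (Fin 2) (Fin 2) ℤ) * ((γ : SL(2, ℤ)) : Matrix (Fin 2) (Fin 2) ℤ)) 1 0 + 2 * (((g₀ : Matrix (Fin 2) (Fin 2) ℤ) * !![u,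 v; 0, w]).adjugate * (((uu⁻¹ : Gamma0 N) : SL(2, ℤ)) : Matrix (Fin 2) (Fin 2) ℤ) * ((γ : SL(2, ℤ)) : Matrix (Fin 2) (Fin 2) ℤ)) 1 1) ∨
          (((((g₀ : Matrix (Fin 2) (Fin 2) ℤ) * !![u, v; 0, w]).adjugate * (((uu⁻¹ : Gamma0 N) : SL(2, ℤ)) : Matrix (Fin 2) (Fin 2) ℤ) * ((γ : SL(2, ℤ)) : Matrix (Fin 2) (Fin 2) ℤ)) 0 0 + 2 * (((g₀ : Matrix (Fin 2) (Fin 2) ℤ) * !![u, v; 0, w]).adjugate * (((uu⁻¹ : Gamma0 N) : SL(2, ℤ)) : Matrix (Fin 2) (Fin 2) ℤ) * ((γ : SL(2, ℤ)) : Matrix (Fin 2) (Fin 2) ℤ)) 0 1) * ((((g₀ : Matrix (Fin 2) (Fin 2) ℤ) * !![u, v; 0, w]).adjugate * (((uu⁻¹ : Gamma0 N) : SL(2, ℤ)) : Matrix (Fin 2) (Fin 2) ℤ) * ((γ : SL(2, ℤ)) : Matrix (Fin 2) (Fin 2) ℤ)) 1 0 + 2 * (((g₀ : Matrix (Fin 2)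 (Fin 2) ℤ) * !![u, v; 0, w]).adjugate * (((uu⁻¹ : Gamma0 N) : SL(2, ℤ)) : Matrix (Fin 2) (Fin 2) ℤ) * ((γ : SL(2, ℤ)) : Matrix (Fin 2) (Fin 2) ℤ)) 1 1) = 0 ∧ 0 < (((g₀ : Matrix (Fin 2) (Fin 2) ℤ) * !![u, v; 0, w]).adjugate * (((uu⁻¹ : Gamma0 N) : SL(2, ℤ)) : Matrix (Fin 2) (Fin 2) ℤ) * ((γ : SL(2, ℤ)) : Matrix (Fin 2) (Fin 2) ℤ)) 0 0 * (((g₀ : Matrix (Fin 2) (Fin 2) ℤ) * !![u, v; 0, w]).adjugate * (((uu⁻¹ : Gamma0 N) : SL(2, ℤ)) : Matrix (Fin 2) (Fin 2) ℤ) * ((γ : SL(2, ℤ)) : Matrix (Fin 2) (Fin 2) ℤ)) 1 1 + (((g₀ : Matrix (Fin 2) (Fin 2) ℤ) * !![u, v; 0, w]).adjugate * (((uu⁻¹ : Gamma0 N) : SL(2, ℤ)) : Matrix (Fin 2) (Fin 2) ℤ) * ((γ : SL(2, ℤ)) : Matrix (Fin 2) (Fin 2) ℤ)) 0 1 * (((g₀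 : Matrix (Fin 2) (Fin 2) ℤ) * !![u, v; 0, w]).adjugate * (((uu⁻¹ : Gamma0 N) : SL(2, ℤ)) : Matrix (Fin 2) (Fin 2) ℤ) * ((γ : SL(2, ℤ)) : Matrix (Fin 2) (Fin 2) ℤ)) 1 0)))) then (1 : ℤ) else 0) -
         (if (0 < (((g₀ : Matrix (Fin 2) (Fin 2) ℤ) * !![u, v; 0, w]).adjugate * (((uu⁻¹ : Gamma0 N) : SL(2, ℤ)) : Matrix (Fin 2) (Fin 2) ℤ)) 0 0 * (((g₀ : Matrix (Fin 2) (Fin 2) ℤ) * !![u, v; 0, w]).adjugate * (((uu⁻¹ : Gamma0 N) : SL(2, ℤ)) : Matrix (Fin 2) (Fin 2) ℤ)) 1 0 ∨ ((((g₀ : Matrix (Fin 2) (Fin 2) ℤ) * !![u, v; 0, w]).adjugate * (((uu⁻¹ : Gamma0 N) : SL(2, ℤ)) : Matrix (Fin 2) (Fin 2) ℤ)) 0 0 * (((g₀ : Matrix (Fin 2) (Fin 2) ℤ) * !![u, v; 0, w]).adjugate * (((uu⁻¹ : Gamma0 N) : SL(2, ℤ)) : Matrix (Fin 2) (Fin 2)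 ℤ)) 1 0 = 0 ∧ (0 < ((((g₀ : Matrix (Fin 2) (Fin 2) ℤ) * !![u, v; 0, w]).adjugate * (((uu⁻¹ : Gamma0 N) : SL(2, ℤ)) : Matrix (Fin 2) (Fin 2) ℤ)) 0 0 + 2 * (((g₀ : Matrix (Fin 2) (Fin 2) ℤ) * !![u, v; 0, w]).adjugate * (((uu⁻¹ : Gamma0 N) : SL(2, ℤ)) : Matrix (Fin 2) (Fin 2) ℤ)) 0 1) * ((((g₀ : Matrix (Fin 2) (Fin 2) ℤ) * !![u, v; 0, w]).adjugate * (((uu⁻¹ : Gamma0 N) : SL(2, ℤ)) : Matrix (Fin 2) (Fin 2) ℤ)) 1 0 + 2 * (((g₀ : Matrix (Fin 2) (Fin 2) ℤ) * !![u, v; 0, w]).adjugate * (((uu⁻¹ : Gamma0 N) : SL(2, ℤ)) : Matrix (Fin 2) (Fin 2) ℤ)) 1 1) ∨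
          (((((g₀ : Matrix (Fin 2) (Fin 2) ℤ) * !![u, v; 0, w]).adjugate * (((uu⁻¹ : Gamma0 N) : SL(2, ℤ)) : Matrix (Fin 2) (Fin 2) ℤ)) 0 0 + 2 * (((g₀ : Matrix (Fin 2) (Fin 2) ℤ) * !![u, v; 0, w]).adjugate * (((uu⁻¹ : Gamma0 N) : SL(2, ℤ)) : Matrix (Fin 2) (Fin 2) ℤ)) 0 1) * ((((g₀ : Matrix (Fin 2) (Fin 2) ℤ) * !![u, v; 0, w]).adjugate * (((uu⁻¹ : Gamma0 N) : SL(2, ℤ)) : Matrix (Fin 2) (Fin 2) ℤ)) 1 0 + 2 * (((g₀ : Matrix (Fin 2) (Fin 2) ℤ) * !![u, v; 0, w]).adjugate * (((uu⁻¹ : Gamma0 N) : SL(2, ℤ)) : Matrix (Fin 2) (Fin 2) ℤ)) 1 1) = 0 ∧ 0 < (((g₀ : Matrix (Fin 2) (Fin 2) ℤ) * !![u, v; 0, w]).adjugate * (((uu⁻¹ : Gamma0 N) : SL(2, ℤ)) : Matrix (Fin 2) (Fin 2) ℤ)) 0 0 * (((g₀ : Matrix (Fin 2) (Fin 2) ℤ)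 * !![u, v; 0, w]).adjugate * (((uu⁻¹ : Gamma0 N) : SL(2, ℤ)) : Matrix (Fin 2) (Fin 2) ℤ)) 1 1 + (((g₀ : Matrix (Fin 2) (Fin 2) ℤ) * !![u, v; 0, w]).adjugate * (((uu⁻¹ : Gamma0 N) : SL(2, ℤ)) : Matrix (Fin 2) (Fin 2) ℤ)) 0 1 * (((g₀ : Matrix (Fin 2) (Fin 2) ℤ) * !![u, v; 0, w]).adjugate * (((uu⁻¹ : Gamma0 N) : SL(2, ℤ)) : Matrix (Fin 2) (Fin 2) ℤ)) 1 0)))) then (1 : ℤ) else 0)) := by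
    intro uu
    rw [lsum, hsumA uu (γ : SL(2, ℤ)), hsumA uu 1, mul_one, Matrix.SpecialLinearGroup.coe_mul, ← Matrix.mul_assoc]
    ring
  rw [finsum_congr hpt]
  -- (b5): split; the κ part cancels
  have hκbr : (Function.support fun uu : Gamma0 N ↦
      -(κ (((uu⁻¹ : Gamma0 N) : SL(2, ℤ)) * γ) - κ ((uu⁻¹ : Gamma0 N) : SL(2, ℤ)))).Finite := by
    apply Set.Finite.subset (s := (Function.support fun uu : Gamma0 N ↦ κ (((uu⁻¹ : Gamma0 N) : SL(2, ℤ)) * γ)) ∪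
      Function.support fun uu : Gamma0 N ↦ κ ((uu⁻¹ : Gamma0 N) : SL(2, ℤ)))
    · refine Set.Finite.union ?_ ?_
      · refine hκfin.preimage ?_
        intro a _ b _ h
        have h' : ((a⁻¹ : Gamma0 N) : SL(2, ℤ)) = ((b⁻¹ : Gamma0 N) : SL(2, ℤ)) := mul_right_cancel h
        exact inv_injective (Subtype.coe_injective h')
      · refine hκfin.preimage ?_
        intro a _ b _ h
        exact inv_injective (Subtype.coe_injective h)
    · intro uu huu
      rw [Function.mem_support] at huu
      by_contra hcon
      simp only [Set.mem_union, Function.mem_support, not_or, not_not] at hcon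
      exact huu (by rw [hcon.1, hcon.2, sub_zero, neg_zero])
  have hFbr : (Function.support fun uu : Gamma0 N ↦
      ((if (0 < (((g₀ : Matrix (Fin 2) (Fin 2) ℤ) * !![u, v; 0, w]).adjugate * (((uu⁻¹ : Gamma0 N) : SL(2, ℤ)) : Matrix (Fin 2) (Fin 2) ℤ) * ((γ : SL(2, ℤ)) : Matrix (Fin 2) (Fin 2) ℤ)) 0 0 * (((g₀ : Matrix (Fin 2) (Fin 2) ℤ) * !![u, v; 0, w]).adjugate * (((uu⁻¹ : Gamma0 N) : SL(2, ℤ)) : Matrix (Fin 2) (Fin 2) ℤ) * ((γ : SL(2, ℤ)) : Matrix (Fin 2) (Fin 2) ℤ)) 1 0 ∨ ((((g₀ : Matrix (Fin 2) (Fin 2) ℤ) * !![u, v; 0, w]).adjugate * (((uu⁻¹ : Gamma0 N) : SL(2, ℤ)) : Matrix (Fin 2) (Fin 2) ℤ) * ((γ : SL(2, ℤ)) : Matrix (Fin 2) (Fin 2) ℤ)) 0 0 * (((g₀ : Matrix (Fin 2) (Fin 2) ℤ) * !![u, v; 0, w]).adjugate * (((uu⁻¹ : Gamma0 N) : SL(2,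 ℤ)) : Matrix (Fin 2) (Fin 2) ℤ) * ((γ : SL(2, ℤ)) : Matrix (Fin 2) (Fin 2) ℤ)) 1 0 = 0 ∧ (0 < ((((g₀ : Matrix (Fin 2) (Fin 2) ℤ) * !![u, v; 0, w]).adjugate * (((uu⁻¹ : Gamma0 N) : SL(2, ℤ)) : Matrix (Fin 2) (Fin 2) ℤ) * ((γ : SL(2, ℤ)) : Matrix (Fin 2) (Fin 2) ℤ)) 0 0 + 2 * (((g₀ : Matrix (Fin 2) (Fin 2) ℤ) * !![u, v; 0, w]).adjugate * (((uu⁻¹ : Gamma0 N) : SL(2, ℤ)) : Matrix (Fin 2) (Fin 2) ℤ) * ((γ : SL(2, ℤ)) : Matrix (Fin 2) (Fin 2) ℤ)) 0 1) * ((((g₀ : Matrix (Fin 2) (Fin 2) ℤ) * !![u, v; 0, w]).adjugate * (((uu⁻¹ : Gamma0 N) : SL(2, ℤ)) : Matrix (Fin 2) (Fin 2) ℤ) * ((γ : SL(2, ℤ)) : Matrix (Fin 2) (Fin 2) ℤ)) 1 0 + 2 * (((g₀ : Matrix (Fin 2) (Fin 2) ℤ) * !![u, v; 0, w]).adjugate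 * (((uu⁻¹ : Gamma0 N) : SL(2, ℤ)) : Matrix (Fin 2) (Fin 2) ℤ) * ((γ : SL(2, ℤ)) : Matrix (Fin 2) (Fin 2) ℤ)) 1 1) ∨
          (((((g₀ : Matrix (Fin 2) (Fin 2) ℤ) * !![u, v; 0, w]).adjugate * (((uu⁻¹ : Gamma0 N) : SL(2, ℤ)) : Matrix (Fin 2) (Fin 2) ℤ) * ((γ : SL(2, ℤ)) : Matrix (Fin 2) (Fin 2) ℤ)) 0 0 + 2 * (((g₀ : Matrix (Fin 2) (Fin 2) ℤ) * !![u, v; 0, w]).adjugate * (((uu⁻¹ : Gamma0 N) : SL(2, ℤ)) : Matrix (Fin 2) (Fin 2) ℤ) * ((γ : SL(2, ℤ)) : Matrix (Fin 2) (Fin 2) ℤ)) 0 1) * ((((g₀ : Matrix (Fin 2) (Fin 2) ℤ) * !![u, v; 0, w]).adjugate * (((uu⁻¹ : Gamma0 N) : SL(2, ℤ)) : Matrix (Fin 2) (Fin 2) ℤ) * ((γ : SL(2, ℤ)) : Matrix (Fin 2) (Fin 2) ℤ)) 1 0 + 2 * (((g₀ : Matrix (Fin 2) (Fin 2) ℤ)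 * !![u, v; 0, w]).adjugate * (((uu⁻¹ : Gamma0 N) : SL(2, ℤ)) : Matrix (Fin 2) (Fin 2) ℤ) * ((γ : SL(2, ℤ)) : Matrix (Fin 2) (Fin 2) ℤ)) 1 1) = 0 ∧ 0 < (((g₀ : Matrix (Fin 2) (Fin 2) ℤ) * !![u, v; 0, w]).adjugate * (((uu⁻¹ : Gamma0 N) : SL(2, ℤ)) : Matrix (Fin 2) (Fin 2) ℤ) * ((γ : SL(2, ℤ)) : Matrix (Fin 2) (Fin 2) ℤ)) 0 0 * (((g₀ : Matrix (Fin 2) (Fin 2) ℤ) * !![u, v; 0, w]).adjugate * (((uu⁻¹ : Gamma0 N) : SL(2, ℤ)) : Matrix (Fin 2) (Fin 2) ℤ) * ((γ : SL(2, ℤ)) : Matrix (Fin 2) (Fin 2) ℤ)) 1 1 + (((g₀ : Matrix (Fin 2) (Fin 2) ℤ) * !![u, v; 0, w]).adjugate * (((uu⁻¹ : Gamma0 N) : SL(2, ℤ)) : Matrix (Fin 2) (Fin 2) ℤ) * ((γ : SL(2, ℤ)) : Matrix (Fin 2) (Fin 2) ℤ)) 0 1 * (((g₀ : Matrix (Fin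 2) (Fin 2) ℤ) * !![u, v; 0, w]).adjugate * (((uu⁻¹ : Gamma0 N) : SL(2, ℤ)) : Matrix (Fin 2) (Fin 2) ℤ) * ((γ : SL(2, ℤ)) : Matrix (Fin 2) (Fin 2) ℤ)) 1 0)))) then (1 : ℤ) else 0) -
       (if (0 < (((g₀ : Matrix (Fin 2) (Fin 2) ℤ) * !![u, v; 0, w]).adjugate * (((uu⁻¹ : Gamma0 N) : SL(2, ℤ)) : Matrix (Fin 2) (Fin 2) ℤ)) 0 0 * (((g₀ : Matrix (Fin 2) (Fin 2) ℤ) * !![u, v; 0, w]).adjugate * (((uu⁻¹ : Gamma0 N) : SL(2, ℤ)) : Matrix (Fin 2) (Fin 2) ℤ)) 1 0 ∨ ((((g₀ : Matrix (Fin 2) (Fin 2) ℤ) * !![u, v; 0, w]).adjugate * (((uu⁻¹ : Gamma0 N) : SL(2, ℤ)) : Matrix (Fin 2) (Fin 2) ℤ)) 0 0 * (((g₀ : Matrix (Fin 2) (Fin 2) ℤ) * !![u, v; 0, w]).adjugate * (((uu⁻¹ : Gamma0 N) : SL(2, ℤ)) : Matrix (Fin 2) (Fin 2) ℤ)) 1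 0 = 0 ∧ (0 < ((((g₀ : Matrix (Fin 2) (Fin 2) ℤ) * !![u, v; 0, w]).adjugate * (((uu⁻¹ : Gamma0 N) : SL(2, ℤ)) : Matrix (Fin 2) (Fin 2) ℤ)) 0 0 + 2 * (((g₀ : Matrix (Fin 2) (Fin 2) ℤ) * !![u, v; 0, w]).adjugate * (((uu⁻¹ : Gamma0 N) : SL(2, ℤ)) : Matrix (Fin 2) (Fin 2) ℤ)) 0 1) * ((((g₀ : Matrix (Fin 2) (Fin 2) ℤ) * !![u, v; 0, w]).adjugate * (((uu⁻¹ : Gamma0 N) : SL(2, ℤ)) : Matrix (Fin 2) (Fin 2) ℤ)) 1 0 + 2 * (((g₀ : Matrix (Fin 2) (Fin 2) ℤ) * !![u, v; 0, w]).adjugate * (((uu⁻¹ : Gamma0 N) : SL(2, ℤ)) : Matrix (Fin 2) (Fin 2) ℤ)) 1 1) ∨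
          (((((g₀ : Matrix (Fin 2) (Fin 2) ℤ) * !![u, v; 0, w]).adjugate * (((uu⁻¹ : Gamma0 N) : SL(2, ℤ)) : Matrix (Fin 2) (Fin 2) ℤ)) 0 0 + 2 * (((g₀ : Matrix (Fin 2) (Fin 2) ℤ) * !![u, v; 0, w]).adjugate * (((uu⁻¹ : Gamma0 N) : SL(2, ℤ)) : Matrix (Fin 2) (Fin 2) ℤ)) 0 1) * ((((g₀ : Matrix (Fin 2) (Fin 2) ℤ) * !![u, v; 0, w]).adjugate * (((uu⁻¹ : Gamma0 N) : SL(2, ℤ)) : Matrix (Fin 2) (Fin 2) ℤ)) 1 0 + 2 * (((g₀ : Matrix (Fin 2) (Fin 2) ℤ) * !![u, v; 0, w]).adjugate * (((uu⁻¹ : Gamma0 N) : SL(2, ℤ)) : Matrix (Fin 2) (Fin 2) ℤ)) 1 1) = 0 ∧ 0 < (((g₀ : Matrix (Fin 2) (Fin 2) ℤ) * !![u, v; 0, w]).adjugate * (((uu⁻¹ : Gamma0 N) : SL(2, ℤ)) : Matrix (Fin 2) (Fin 2) ℤ)) 0 0 * (((g₀ : Matrix (Fin 2) (Fin 2) ℤ)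 * !![u, v; 0, w]).adjugate * (((uu⁻¹ : Gamma0 N) : SL(2, ℤ)) : Matrix (Fin 2) (Fin 2) ℤ)) 1 1 + (((g₀ : Matrix (Fin 2) (Fin 2) ℤ) * !![u, v; 0, w]).adjugate * (((uu⁻¹ : Gamma0 N) : SL(2, ℤ)) : Matrix (Fin 2) (Fin 2) ℤ)) 0 1 * (((g₀ : Matrix (Fin 2) (Fin 2) ℤ) * !![u, v; 0, w]).adjugate * (((uu⁻¹ : Gamma0 N) : SL(2, ℤ)) : Matrix (Fin 2) (Fin 2) ℤ)) 1 0)))) then (1 : ℤ) else 0))).Finite := by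
    apply Set.Finite.subset (htotfin.union hκbr)
    intro uu huu
    rw [Function.mem_support] at huu
    by_contra hcon
    simp only [Set.mem_union, Function.mem_support, not_or, not_not] at hcon
    have h1 := hcon.1
    rw [hpt uu, hcon.2, zero_sub, neg_eq_zero] at h1
    exact huu h1
  rw [finsum_sub_distrib hκbr hFbr, finsum_neg_distrib, finsum_kappa_cancel κ hκfin γ, neg_zero, zero_sub]

end ManinBlock

end Summit.BirchSwinnertonDyer.BirchSwinnertonDyer.Theorems.ThetaLayerLambdaCongruenceAtTwo

end
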